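import Literature.Computability.QuantumComplexity.PauliPathIntegral
import HarnessLib

/-!
# Probabilistic error cancellation: quasi-probability representations of ideal gates by noisy ones,
  the overhead `γ`, and the single-qubit depolarizing inverse of Temme–Bravyi–Gambetta (2017)

Topic `Literature/Computability/QuantumComplexity` (pub-qadeq lane; companion of
`ZeroNoiseExtrapolation.lean`). CLAIMS E-17 (IBM utility experiment) weighs this method against ZNE
on p. 2–3 of [KimEtAl2023]: "Probabilistic error cancellation (PEC) has been shown to be very
effective at providing unbiased estimates of observables. In PEC, a representative noise model is
learned and effectively inverted by sampling from a distribution of noisy circuits related to the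
learned model. Yet, for the current error rates on our device, the sampling overhead for the circuit
volumes considered in this work remains restrictive" (p. 2) … "In PEC, we choose `α = −1` to obtain
an overall zero-gain noise level" (p. 3) — the overhead below is the quantity those sentences refer
to (E-44 / E-47 likewise).

HONEST FRAMING: instance-level adjudication of specific advantage claims; no claim about BQP vs BPP
or the summit. Nothing here says that any device's noise IS single-qubit depolarizing or is known;
the file fixes the ARITHMETIC of the quasi-probability method as printed — what an exact
representation buys (an unbiased combination), why its overhead is at least `1`, how overheads
multiply, and the printed single-qubit depolarizing inverse with its overhead and sampling
probabilities — in the tree's Pauli vocabulary (`PauliExpansion.lean`, `PauliLocal.lean`,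
`PauliPathIntegral.lean`'s `depolarizeWire`).

## Source (verbatim)

[TemmeBravyiGambetta2017] K. Temme, S. Bravyi, J. M. Gambetta, PRL 119, 180509 (2017) =
arXiv:1612.02058 (tex chunks p0004–p0005 and SM §IV–§V = chunks p0012–p0013 of
`lit read arxiv:1612.02058`). Main text: "Let us say that a noisy basis `Ω` simulates an ideal
circuit `β` with the overhead `γ_β ≥ 1` if there exists a probability distribution `P_β(α)` on
the set of noisy circuits `α ∈ Ω_L` such that `𝒰_β = γ_β Σ_{α∈Ω_L} P_β(α) σ_β(α) 𝒪_α` (ppr1) for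
some coefficients `σ_β(α) = ±1`. … Note that `γ_β ≥ 1` because `𝒰_β` and `𝒪_α` are
trace-preserving. … Substituting Eq. (ppr1) into the definition of `E*(β)` gives
`E*(β) = γ_β Σ_{α∈Ω_L} P_β(α) σ_β(α) E(α)` (ppr3)" … "`γ_β σ_β(α) ⟨x|A|x⟩` is an unbiased estimator
of the ideal expectation value `E*(β)` with the variance `O(γ_β²)` … Define `M = (δ⁻¹ γ_β)²`
(samples) … Thus the quantity `γ_β²` determines the simulation overhead". SM §IV: "A product QPR of
the ideal circuit `β` is defined as a product of all gate-wise QPRs Eq. (local). It gives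
`γ_β = γ_{β_1} ⋯ γ_{β_L}`, `P_β(α) = P_{β_1}(α_1) ⋯ P_{β_L}(α_L)` and
`σ_β(α) = σ_{β_1}(α_1) ⋯ σ_{β_L}(α_L)`." SM §V (single-qubit depolarizing noise `𝒟_1` "that returns
the maximally mixed state with probability `ε` and does nothing with probability `1 − ε`", noisy
operations `𝒪_α = 𝒟_1 𝒫_α 𝒰_β`, `𝒫(ρ) = PρP`): "Then Eq. (LP1) is equivalent to
`𝒟_1⁻¹ = η_1 𝒫_1 + η_2 𝒫_2 + η_3 𝒫_3 + η_4 𝒫_4`. One can easily check that the optimal solution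
minimizing `Σ_α |η_α|` is `η_1 = 1 + 3ε/4(1−ε)` and `η_α = −ε/4(1−ε)` for `α = 2,3,4`. Therefore
`γ_β = Σ_α |η_α| = (1+ε/2)/(1−ε)`." … "adding a Pauli `X,Y,Z` after each single-qubit gate with
probability `p_1 = ε/(4+2ε)`. The gate is unchanged with probability `1 − 3p_1`. … The sign function
`σ_β(α)` is equal to `(−1)^r`, where `r` is the number of Pauli operators added"; and for two qubits
"simulates CNOTs with the overhead `γ_β = (1+7ε/8)/(1−ε)`", "`p_2 = ε/(16+14ε)`".

## Contents (all proved, 0 named facts)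

Generic part (maps `Matrix m m ℂ → Matrix m m ℂ` on any finite index type; a finite family of
noisy operations indexed by `α`):
* `IsQPR 𝒰 γ P σ 𝒪` — eq. (ppr1) as a predicate: `𝒰 ρ = Σ_a (γ P(a) σ(a)) • 𝒪_a ρ` for all `ρ`.
* `IsQPR.expectation_eq` — **eq. (ppr3)**: `Tr(A·𝒰ρ) = Σ_a γ P(a) σ(a) Tr(A·𝒪_a ρ)`; this is also
  the statement that one draw `a ∼ P` scored `γ σ(a) E(a)` is an UNBIASED estimator of `E*`
  (`IsQPR.sum_prob_mul_estimator`); `abs_estimator_le` (`|γ σ(a) v| ≤ γ` for `|v| ≤ 1`: the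
  `O(γ²)` variance / Hoeffding range; `sampleCount γ δ = (γ/δ)²` is the printed `M`).
* `IsQPR.one_le_overhead` — **"`γ_β ≥ 1` because `𝒰_β` and `𝒪_α` are trace-preserving"**.
* `IsQPR.comp` — **product QPRs**: overheads multiply, probabilities and signs multiply (SM §IV).

Single-qubit depolarizing instance (SM §V) on the tree's register `ι → Bool`, wire `j`:
* `pauliConj j Q` (`𝒫_Q` at wire `j`), `invCoeff ε Q` (the printed `η`'s),
  `sum_invCoeff` (`Σ_Q η_Q = 1`), `sum_invCoeff_mul_sign` (`Σ_Q η_Q sign(Q,P) = 1/(1−ε)`, `P ≠ I`);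
* **`𝒟_1⁻¹ = Σ_Q η_Q 𝒫_Q`**: `sum_invCoeff_smul_pauliConj_depolarizeWire` (left inverse) and
  `depolarizeWire_sum_invCoeff_smul_pauliConj` (right inverse), for every `ε ≠ 1`;
* the QPR of an ideal gate by the noisy operations `𝒟_1 𝒫_Q 𝒰`: `overhead ε = (1+ε/2)/(1−ε)`,
  `prob ε Q` (`= ε/(4+2ε)` for `Q ≠ I`, `1 − 3ε/(4+2ε)` for `Q = I`), `sgn Q = (−1)^{[Q ≠ I]}`,
  `overhead_mul_prob_mul_sgn` (`γ P(Q) σ(Q) = η_Q`), `isQPR_noisyPauliGate`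
  (**`𝒰 = γ Σ_Q P(Q) σ(Q) · 𝒟_1 𝒫_Q 𝒰`** for every map `𝒰` and every `0 ≤ ε < 1`),
  `overhead_eq_sum_abs_invCoeff` (`γ = Σ_Q |η_Q|`), `overhead_eq_one_add`
  (`γ = 1 + (3/2)·ε/(1−ε)`, so `γ ≥ 1 + 3ε/2`), `sum_prob` / `prob_nonneg`;
* `overheadK` / `probK`: the `k`-qubit arithmetic `(1 + (1 − 2·4^{−k})ε)/(1−ε)` and
  `ε/(4^k + (4^k − 2)ε)` from the same `η`-pattern (`η_I = 1 + (4^k−1)ε/(4^k(1−ε))`,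
  `η_{P≠I} = −ε/(4^k(1−ε))`), giving the printed `(1+ε/2)/(1−ε)`, `ε/(4+2ε)` at `k = 1` and
  `(1+7ε/8)/(1−ε)`, `ε/(16+14ε)` at `k = 2` (`overheadK_one`, `overheadK_two`, `probK_two`) — pure
  arithmetic; only `k = 1` is tied here to a channel of the tree (`depolarizeWire`).

Not formalised: the linear program (LP)/(LP1) and the OPTIMALITY of the `η`'s (we prove they give
AN inverse with the printed overhead, not that no cheaper QPR exists), Hoeffding's inequality behind
`M = (γ/δ)²`, the amplitude-damping construction of SM §V, gate tomography, and IBM's sparse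
Pauli–Lindblad learning/PEA; nothing about any device.
-/

noncomputable section

open Matrix Finset

namespace Literature.Computability.QuantumComplexity

namespace PEC

/-! ### Quasi-probability representations in general -/

section QPR

variable {m : Type*} [Fintype m] {α β : Type*} [Fintype α] [Fintype β]

/-- **Quasi-probability representation** (eq. (ppr1)): the ideal map `𝒰` is the signed, `γ`-scaled
mixture `𝒰 = γ Σ_a P(a) σ(a) 𝒪_a` of the noisy maps `𝒪_a`. (`P` is meant to be a probability vector
and `σ = ±1`; those properties are hypotheses of the lemmas that need them.)
[cite: TemmeBravyiGambetta2017, eq. (ppr1)] -/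
def IsQPR (𝒰 : Matrix m m ℂ → Matrix m m ℂ) (γ : ℝ) (P σ : α → ℝ)
    (𝒪 : α → Matrix m m ℂ → Matrix m m ℂ) : Prop :=
  ∀ ρ, 𝒰 ρ = ∑ a, ((γ * P a * σ a : ℝ) : ℂ) • 𝒪 a ρ

/-- **Eq. (ppr3)**: expectation values inherit the representation,
`E* = Tr(A 𝒰(ρ)) = Σ_a γ P(a) σ(a) Tr(A 𝒪_a(ρ)) = γ Σ_a P(a) σ(a) E(a)`.
[cite: TemmeBravyiGambetta2017, eq. (ppr3)] -/
theorem IsQPR.expectation_eq {𝒰 : Matrix m m ℂ → Matrix m m ℂ} {γ : ℝ} {P σ : α → ℝ}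
    {𝒪 : α → Matrix m m ℂ → Matrix m m ℂ} (h : IsQPR 𝒰 γ P σ 𝒪) (A ρ : Matrix m m ℂ) :
    (A * 𝒰 ρ).trace = ∑ a, ((γ * P a * σ a : ℝ) : ℂ) * (A * 𝒪 a ρ).trace := by
  rw [h ρ, Matrix.mul_sum, trace_sum]
  exact sum_congr rfl fun a _ => by rw [Matrix.mul_smul, trace_smul, smul_eq_mul]

/-- **Unbiasedness of the single-sample estimator**: drawing `a` with probability `P(a)` and scoring
`γ σ(a) E(a)` has mean `Σ_a P(a) · (γ σ(a) E(a)) = E*` — "`γ_β σ_β(α)⟨x|A|x⟩` is an unbiased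
estimator of the ideal expectation value `E*(β)`" (the inner `⟨x|A|x⟩`-average being `E(α)`).
[cite: TemmeBravyiGambetta2017, main text (paragraph after eq. (ppr3))] -/
theorem IsQPR.sum_prob_mul_estimator {𝒰 : Matrix m m ℂ → Matrix m m ℂ} {γ : ℝ} {P σ : α → ℝ}
    {𝒪 : α → Matrix m m ℂ → Matrix m m ℂ} (h : IsQPR 𝒰 γ P σ 𝒪) (A ρ : Matrix m m ℂ) :
    ∑ a, (P a : ℂ) * ((γ * σ a : ℝ) * (A * 𝒪 a ρ).trace) = (A * 𝒰 ρ).trace := by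
  rw [h.expectation_eq A ρ]
  refine sum_congr rfl fun a _ => ?_
  push_cast
  ring

omit [Fintype α] in
/-- The single-sample score is bounded by the overhead: `|γ σ(a) v| ≤ γ` when `|σ(a)| ≤ 1` and
`|v| ≤ 1` (`‖A‖ ≤ 1`) — the range behind "with the variance `O(γ_β²)`" and Hoeffding's bound.
[cite: TemmeBravyiGambetta2017, main text (paragraph after eq. (ppr3))] -/
theorem abs_estimator_le {γ : ℝ} (hγ : 0 ≤ γ) {σ : α → ℝ} (hσ : ∀ a, |σ a| ≤ 1) (a : α) {v : ℝ}
    (hv : |v| ≤ 1) : |γ * σ a * v| ≤ γ := by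
  rw [abs_mul, abs_mul, abs_of_nonneg hγ]
  calc γ * |σ a| * |v| ≤ γ * 1 * 1 :=
        mul_le_mul (mul_le_mul_of_nonneg_left (hσ a) hγ) hv (abs_nonneg v) (by rw [mul_one]; exact hγ)
    _ = γ := by ring

omit [Fintype α] in
/-- The printed number of samples `M = (δ⁻¹ γ)²` for precision `δ` (Hoeffding; not re-proved here):
"Thus the quantity `γ_β²` determines the simulation overhead". [cite: TemmeBravyiGambetta2017, eq. (samples)] -/
def sampleCount (γ δ : ℝ) : ℝ :=
  (γ / δ) ^ 2

omit [Fintype α] in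
/-- `M = γ²/δ²`. [cite: TemmeBravyiGambetta2017, eq. (samples)] -/
theorem sampleCount_eq (γ δ : ℝ) : sampleCount γ δ = γ ^ 2 / δ ^ 2 := by
  rw [sampleCount, div_pow]

/-- **"`γ_β ≥ 1` because `𝒰_β` and `𝒪_α` are trace-preserving"**: if some unit-trace `ρ` keeps unit
trace under `𝒰` and under every `𝒪_a`, `P` is a probability vector, `|σ| ≤ 1` and `γ ≥ 0`, then
`1 ≤ γ`. [cite: TemmeBravyiGambetta2017, main text (sentence after eq. (ppr1))] -/
theorem IsQPR.one_le_overhead [DecidableEq m] {𝒰 : Matrix m m ℂ → Matrix m m ℂ} {γ : ℝ} {P σ : α → ℝ}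
    {𝒪 : α → Matrix m m ℂ → Matrix m m ℂ} (h : IsQPR 𝒰 γ P σ 𝒪) (hγ : 0 ≤ γ)
    (hP : ∀ a, 0 ≤ P a) (hP1 : ∑ a, P a = 1) (hσ : ∀ a, |σ a| ≤ 1) {ρ : Matrix m m ℂ}
    (hU : (𝒰 ρ).trace = 1) (hO : ∀ a, (𝒪 a ρ).trace = 1) : 1 ≤ γ := by
  have h1 := h.expectation_eq 1 ρ
  simp only [Matrix.one_mul, hU, hO, mul_one] at h1
  have hreal : (1 : ℝ) = ∑ a, γ * P a * σ a := by exact_mod_cast h1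
  calc (1 : ℝ) = ∑ a, γ * P a * σ a := hreal
    _ ≤ ∑ a, γ * P a * 1 := sum_le_sum fun a _ =>
        mul_le_mul_of_nonneg_left ((le_abs_self _).trans (hσ a)) (mul_nonneg hγ (hP a))
    _ = γ := by simp only [mul_one]; rw [← Finset.mul_sum, hP1, mul_one]

omit [Fintype m] in
/-- **Product QPRs**: representations of `𝒰₁` (noisy maps `𝒪₁`) and of `𝒰₂` (LINEAR noisy maps
`𝒪₂`) compose to a representation of `𝒰₂ ∘ 𝒰₁` by the composites `𝒪₂(b) ∘ 𝒪₁(a)`, with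
`γ = γ₁γ₂`, `P(a,b) = P₁(a)P₂(b)`, `σ(a,b) = σ₁(a)σ₂(b)` — "`γ_β = γ_{β_1}⋯γ_{β_L}`,
`P_β(α) = P_{β_1}(α_1)⋯P_{β_L}(α_L)` and `σ_β(α) = σ_{β_1}(α_1)⋯σ_{β_L}(α_L)`".
[cite: TemmeBravyiGambetta2017, SM §IV (product QPR)] -/
theorem IsQPR.comp {𝒰₁ 𝒰₂ : Matrix m m ℂ → Matrix m m ℂ} {γ₁ γ₂ : ℝ} {P₁ σ₁ : α → ℝ}
    {P₂ σ₂ : β → ℝ} {𝒪₁ : α → Matrix m m ℂ → Matrix m m ℂ}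
    {𝒪₂ : β → Matrix m m ℂ →ₗ[ℂ] Matrix m m ℂ}
    (h₁ : IsQPR 𝒰₁ γ₁ P₁ σ₁ 𝒪₁) (h₂ : IsQPR 𝒰₂ γ₂ P₂ σ₂ fun b => ⇑(𝒪₂ b)) :
    IsQPR (𝒰₂ ∘ 𝒰₁) (γ₁ * γ₂) (fun ab : α × β => P₁ ab.1 * P₂ ab.2)
      (fun ab => σ₁ ab.1 * σ₂ ab.2) (fun ab ρ => 𝒪₂ ab.2 (𝒪₁ ab.1 ρ)) := by
  intro ρ
  rw [Function.comp_apply, h₂ (𝒰₁ ρ), h₁ ρ, Fintype.sum_prod_type_right]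
  refine sum_congr rfl fun b _ => ?_
  dsimp only
  rw [map_sum, Finset.smul_sum]
  refine sum_congr rfl fun a _ => ?_
  rw [map_smul, smul_smul]
  congr 1
  push_cast
  ring

end QPR

/-! ### The single-qubit depolarizing inverse (SM §V) on the tree's `depolarizeWire` -/

section Depolarizing

open PauliPath

variable {ι : Type*} [Fintype ι] [DecidableEq ι]

/-- The Pauli conjugation map `𝒫_Q(N) = σ_Q^{(j)} N σ_Q^{(j)}` at wire `j` ("A Pauli map `𝒫`
corresponding to a Pauli operator `P` is defined by `𝒫(ρ) = PρP`").
[cite: TemmeBravyiGambetta2017, SM §V] -/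
def pauliConj (j : ι) (Q : Pauli) (N : Matrix (ι → Bool) (ι → Bool) ℂ) :
    Matrix (ι → Bool) (ι → Bool) ℂ :=
  pauliString (Function.update (fun _ : ι => Pauli.I) j Q) * N *
    pauliString (Function.update (fun _ : ι => Pauli.I) j Q)

/-- `𝒫_Q` in the Pauli picture: `Tr(S 𝒫_Q(N)) = sign(Q, S_j) Tr(S N)`.
[cite: TemmeBravyiGambetta2017, SM §V] -/
theorem pauliCoeff_pauliConj (j : ι) (Q : Pauli) (N : Matrix (ι → Bool) (ι → Bool) ℂ)
    (S : ι → Pauli) : pauliCoeff (pauliConj j Q N) S = Pauli.sign Q (S j) * pauliCoeff N S :=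
  pauliCoeff_single_conj j Q N S

/-- `𝒟_1` in the Pauli picture: the components with `S_j ≠ I` shrink by `1 − ε`.
[cite: TemmeBravyiGambetta2017, SM §V ("returns the maximally mixed state with probability ε")] -/
theorem pauliCoeff_depolarizeWire (ε : ℂ) (j : ι) (N : Matrix (ι → Bool) (ι → Bool) ℂ)
    (S : ι → Pauli) :
    pauliCoeff (depolarizeWire ε j N) S = (if S j = Pauli.I then 1 else 1 - ε) * pauliCoeff N S :=
  pauliCoeff_depolarize ε j N S

/-- The printed coefficients of `𝒟_1⁻¹`: `η_I = 1 + 3ε/(4(1−ε))`, `η_X = η_Y = η_Z = −ε/(4(1−ε))`.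
[cite: TemmeBravyiGambetta2017, SM §V ("η_1 = 1 + 3ε/4(1−ε) and η_α = −ε/4(1−ε) for α = 2,3,4")] -/
def invCoeff (ε : ℝ) (Q : Pauli) : ℝ :=
  if Q = Pauli.I then 1 + 3 * ε / (4 * (1 - ε)) else -ε / (4 * (1 - ε))

omit [Fintype ι] [DecidableEq ι] in
/-- `Σ_Q η_Q = 1` (trace preservation of `𝒟_1⁻¹`). [cite: TemmeBravyiGambetta2017, SM §V] -/
theorem sum_invCoeff {ε : ℝ} (hε : ε ≠ 1) : ∑ Q, invCoeff ε Q = 1 := by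
  have h1 : (1 - ε) ≠ 0 := sub_ne_zero.2 (Ne.symm hε)
  rw [Pauli.sum_univ]
  simp only [invCoeff]
  simp only [reduceCtorEq, if_true, if_false]
  field_simp
  ring

omit [Fintype ι] [DecidableEq ι] in
/-- For `P ≠ I`: `Σ_Q η_Q sign(Q,P) = η_I − η = 1/(1−ε)` (the non-identity components are divided
by `1 − ε`). [cite: TemmeBravyiGambetta2017, SM §V] -/
theorem sum_invCoeff_mul_sign {ε : ℝ} (hε : ε ≠ 1) {P : Pauli} (hP : P ≠ Pauli.I) :
    ∑ Q, (invCoeff ε Q : ℂ) * Pauli.sign Q P = ((1 / (1 - ε) : ℝ) : ℂ) := by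
  have h1 : (1 - ε) ≠ 0 := sub_ne_zero.2 (Ne.symm hε)
  have h1c : ((1 : ℂ) - ε) ≠ 0 := by exact_mod_cast h1
  rw [Pauli.sum_univ]
  cases P with
  | I => exact absurd rfl hP
  | X =>
      simp only [invCoeff, Pauli.sign, reduceCtorEq, if_true, if_false, or_false, or_true]
      push_cast
      field_simp
      ring
  | Y =>
      simp only [invCoeff, Pauli.sign, reduceCtorEq, if_true, if_false, or_false, or_true]
      push_cast
      field_simp
      ring
  | Z =>
      simp only [invCoeff, Pauli.sign, reduceCtorEq, if_true, if_false, or_false, or_true]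
      push_cast
      field_simp
      ring

omit [Fintype ι] [DecidableEq ι] in
/-- For `P = I`: every sign is `+1`, so `Σ_Q η_Q sign(Q,I) = 1`. [cite: TemmeBravyiGambetta2017, SM §V] -/
theorem sum_invCoeff_mul_sign_I {ε : ℝ} (hε : ε ≠ 1) :
    ∑ Q, (invCoeff ε Q : ℂ) * Pauli.sign Q Pauli.I = 1 := by
  have : ∀ Q, Pauli.sign Q Pauli.I = 1 := fun Q => by simp [Pauli.sign]
  simp only [this, mul_one]
  exact_mod_cast sum_invCoeff hε

/-- **`𝒟_1⁻¹ 𝒟_1 = id`**: the signed Pauli mixture with the printed coefficients undoes one-wire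
depolarizing noise of any rate `ε ≠ 1` (left inverse).
[cite: TemmeBravyiGambetta2017, SM §V ("𝒟_1⁻¹ = η_1𝒫_1 + η_2𝒫_2 + η_3𝒫_3 + η_4𝒫_4")] -/
theorem sum_invCoeff_smul_pauliConj_depolarizeWire {ε : ℝ} (hε : ε ≠ 1) (j : ι)
    (N : Matrix (ι → Bool) (ι → Bool) ℂ) :
    ∑ Q, (invCoeff ε Q : ℂ) • pauliConj j Q (depolarizeWire (ε : ℂ) j N) = N := by
  refine eq_of_forall_pauliCoeff_eq fun S => ?_
  rw [pauliCoeff_sum]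
  simp only [pauliCoeff_smul, pauliCoeff_pauliConj, pauliCoeff_depolarizeWire]
  by_cases hS : S j = Pauli.I
  · simp only [hS, if_true, one_mul, ← mul_assoc, ← Finset.sum_mul, sum_invCoeff_mul_sign_I hε]
  · simp only [hS, if_false, ← mul_assoc, ← Finset.sum_mul, sum_invCoeff_mul_sign hε hS]
    have h1 : ((1 : ℂ) - ε) ≠ 0 := by exact_mod_cast sub_ne_zero.2 (Ne.symm hε)
    push_cast
    field_simp

/-- Additivity of `𝒫_Q`. [folklore] -/
private theorem pauliConj_add (j : ι) (Q : Pauli) (M N : Matrix (ι → Bool) (ι → Bool) ℂ) :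
    pauliConj j Q (M + N) = pauliConj j Q M + pauliConj j Q N := by
  simp only [pauliConj, Matrix.mul_add, Matrix.add_mul]

/-- **`𝒟_1 𝒟_1⁻¹ = id`** (right inverse): applying the noise after the signed Pauli mixture also
returns the input — the form used when the noise FOLLOWS the inserted Pauli (`𝒪_α = 𝒟_1 𝒫_α 𝒰_β`).
[cite: TemmeBravyiGambetta2017, SM §V] -/
theorem depolarizeWire_sum_invCoeff_smul_pauliConj {ε : ℝ} (hε : ε ≠ 1) (j : ι)
    (N : Matrix (ι → Bool) (ι → Bool) ℂ) :
    depolarizeWire (ε : ℂ) j (∑ Q, (invCoeff ε Q : ℂ) • pauliConj j Q N) = N := by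
  refine eq_of_forall_pauliCoeff_eq fun S => ?_
  rw [pauliCoeff_depolarizeWire, pauliCoeff_sum]
  simp only [pauliCoeff_smul, pauliCoeff_pauliConj]
  by_cases hS : S j = Pauli.I
  · simp only [hS, if_true, one_mul, ← mul_assoc, ← Finset.sum_mul, sum_invCoeff_mul_sign_I hε]
  · simp only [hS, if_false, ← mul_assoc, ← Finset.sum_mul, sum_invCoeff_mul_sign hε hS]
    have h1 : ((1 : ℂ) - ε) ≠ 0 := by exact_mod_cast sub_ne_zero.2 (Ne.symm hε)
    push_cast
    field_simp

/-! ### The resulting QPR of an ideal gate: overhead, sampling probabilities, signs -/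

/-- The printed overhead `γ = Σ_α |η_α| = (1 + ε/2)/(1 − ε)`.
[cite: TemmeBravyiGambetta2017, SM §V ("γ_β = Σ_α|η_α| = (1+ε/2)/(1−ε)")] -/
def overhead (ε : ℝ) : ℝ :=
  (1 + ε / 2) / (1 - ε)

/-- The printed sampling probabilities: a Pauli `X`, `Y` or `Z` is inserted after the gate with
probability `p_1 = ε/(4+2ε)` each, nothing with probability `1 − 3p_1`.
[cite: TemmeBravyiGambetta2017, SM §V ("p_1 = ε/(4+2ε) … unchanged with probability 1−3p_1")] -/
def prob (ε : ℝ) (Q : Pauli) : ℝ :=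
  if Q = Pauli.I then 1 - 3 * (ε / (4 + 2 * ε)) else ε / (4 + 2 * ε)

/-- The printed signs `σ = (−1)^r`, `r` = number of inserted Paulis (here `0` or `1`).
[cite: TemmeBravyiGambetta2017, SM §V ("σ_β(α) is equal to (−1)^r")] -/
def sgn (Q : Pauli) : ℝ :=
  if Q = Pauli.I then 1 else -1

omit [Fintype ι] [DecidableEq ι] in
/-- `γ · P(Q) · σ(Q) = η_Q`: the probabilities and signs ARE the normalised quasi-probabilities.
[cite: TemmeBravyiGambetta2017, SM §IV ("P_β(α) = μ_α/γ_β, σ_β(α) = sgn(η_α)")] -/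
theorem overhead_mul_prob_mul_sgn {ε : ℝ} (hε0 : 0 ≤ ε) (hε1 : ε < 1) (Q : Pauli) :
    overhead ε * prob ε Q * sgn Q = invCoeff ε Q := by
  have h1 : (1 - ε) ≠ 0 := by linarith
  have h2 : (4 + 2 * ε) ≠ 0 := by linarith
  cases Q <;> simp only [overhead, prob, sgn, invCoeff, reduceCtorEq, if_true, if_false] <;>
    field_simp <;> ring

omit [Fintype ι] [DecidableEq ι] in
/-- The probabilities sum to one. [cite: TemmeBravyiGambetta2017, SM §V] -/
theorem sum_prob (ε : ℝ) : ∑ Q, prob ε Q = 1 := by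
  rw [Pauli.sum_univ]
  simp only [prob, reduceCtorEq, if_true, if_false]
  ring

omit [Fintype ι] [DecidableEq ι] in
/-- The probabilities are nonnegative for `0 ≤ ε`. [cite: TemmeBravyiGambetta2017, SM §V] -/
theorem prob_nonneg {ε : ℝ} (hε0 : 0 ≤ ε) (hε1 : ε ≤ 1) (Q : Pauli) : 0 ≤ prob ε Q := by
  have h2 : 0 < 4 + 2 * ε := by linarith
  cases Q <;> simp only [prob, reduceCtorEq, if_true, if_false]
  · have h3 : 3 * (ε / (4 + 2 * ε)) = 3 * ε / (4 + 2 * ε) := by ring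
    rw [h3, sub_nonneg, div_le_one h2]
    linarith
  all_goals exact div_nonneg hε0 h2.le

omit [Fintype ι] [DecidableEq ι] in
/-- `|σ(Q)| = 1`. [cite: TemmeBravyiGambetta2017, eq. (ppr1) ("σ_β(α) = ±1")] -/
theorem abs_sgn (Q : Pauli) : |sgn Q| = 1 := by
  cases Q <;> simp [sgn]

omit [Fintype ι] [DecidableEq ι] in
/-- **`γ = Σ_Q |η_Q|`** for `0 ≤ ε < 1`. [cite: TemmeBravyiGambetta2017, SM §V ("γ_β = Σ_α |η_α|")] -/
theorem overhead_eq_sum_abs_invCoeff {ε : ℝ} (hε0 : 0 ≤ ε) (hε1 : ε < 1) :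
    overhead ε = ∑ Q, |invCoeff ε Q| := by
  have h1 : 0 < 1 - ε := by linarith
  have hI : 0 ≤ 1 + 3 * ε / (4 * (1 - ε)) := by positivity
  have hX : -ε / (4 * (1 - ε)) ≤ 0 :=
    div_nonpos_of_nonpos_of_nonneg (neg_nonpos.2 hε0) (by positivity)
  rw [Pauli.sum_univ]
  simp only [invCoeff, reduceCtorEq, if_true, if_false, abs_of_nonneg hI, abs_of_nonpos hX, overhead]
  field_simp
  ring

omit [Fintype ι] [DecidableEq ι] in
/-- **`γ = 1 + (3/2)·ε/(1−ε)`**, the exact form of the printed first-order "`γ_β ≈ 1 + ε·3/2` per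
single-qubit gate" (main text: "`γ_β ≲ 1+ε(3L_1/2 + 15L_2/8)`").
[cite: TemmeBravyiGambetta2017, main text (overhead of the depolarizing example)] -/
theorem overhead_eq_one_add {ε : ℝ} (hε1 : ε ≠ 1) : overhead ε = 1 + 3 / 2 * (ε / (1 - ε)) := by
  have h1 : (1 - ε) ≠ 0 := sub_ne_zero.2 (Ne.symm hε1)
  rw [overhead]
  field_simp
  ring

omit [Fintype ι] [DecidableEq ι] in
/-- Hence `γ ≥ 1 + 3ε/2 ≥ 1` on `0 ≤ ε < 1`. [cite: TemmeBravyiGambetta2017, main text] -/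
theorem one_add_le_overhead {ε : ℝ} (hε0 : 0 ≤ ε) (hε1 : ε < 1) : 1 + 3 / 2 * ε ≤ overhead ε := by
  rw [overhead_eq_one_add hε1.ne]
  have h1 : 0 < 1 - ε := by linarith
  have : ε ≤ ε / (1 - ε) := by
    rw [le_div_iff₀ h1]
    nlinarith
  linarith

/-- Linearity of `𝒟_1` over finite signed mixtures. [cite: TemmeBravyiGambetta2017, SM §IV (TPCP maps are linear)] -/
theorem depolarizeWire_sum_smul {κ : Type*} (s : Finset κ) (ε : ℂ) (j : ι) (c : κ → ℂ)
    (M : κ → Matrix (ι → Bool) (ι → Bool) ℂ) :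
    depolarizeWire ε j (∑ k ∈ s, c k • M k) = ∑ k ∈ s, c k • depolarizeWire ε j (M k) := by
  classical
  induction s using Finset.induction_on with
  | empty =>
      rw [Finset.sum_empty, Finset.sum_empty]
      simpa using depolarizeWire_smul ε j 0 0
  | insert k s hk ih =>
      rw [Finset.sum_insert hk, Finset.sum_insert hk, depolarizeWire_add, depolarizeWire_smul, ih]

/-- **The QPR of an ideal gate by Pauli-twirled noisy gates**: for EVERY map `𝒰` (the ideal gate)
and every `0 ≤ ε < 1`, `𝒰 = γ Σ_Q P(Q) σ(Q) · 𝒟_1 𝒫_Q 𝒰` with the printed `γ`, `P`, `σ` — the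
noisy operations being "ideal gate, then a Pauli, then the depolarizing noise" (`𝒪_α = 𝒟_1𝒫_α𝒰_β`).
[cite: TemmeBravyiGambetta2017, SM §V (the three-step construction and eq. (LP1))] -/
theorem isQPR_noisyPauliGate {ε : ℝ} (hε0 : 0 ≤ ε) (hε1 : ε < 1) (j : ι)
    (𝒰 : Matrix (ι → Bool) (ι → Bool) ℂ → Matrix (ι → Bool) (ι → Bool) ℂ) :
    IsQPR 𝒰 (overhead ε) (prob ε) sgn
      (fun Q ρ => depolarizeWire (ε : ℂ) j (pauliConj j Q (𝒰 ρ))) := by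
  intro ρ
  simp only [overhead_mul_prob_mul_sgn hε0 hε1]
  rw [← depolarizeWire_sum_smul, depolarizeWire_sum_invCoeff_smul_pauliConj hε1.ne]

/-- The abstract lower bound `γ ≥ 1` (`IsQPR.one_le_overhead`) is consistent with the instance:
here directly `1 ≤ overhead ε`. [cite: TemmeBravyiGambetta2017, main text ("γ_β ≥ 1")] -/
theorem one_le_overhead {ε : ℝ} (hε0 : 0 ≤ ε) (hε1 : ε < 1) : 1 ≤ overhead ε :=
  le_trans (by linarith) (one_add_le_overhead hε0 hε1)

/-! ### The `k`-qubit arithmetic (`k = 1`: the above; `k = 2`: the printed CNOT numbers) -/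

omit [Fintype ι] [DecidableEq ι] in
/-- The same `η`-pattern on `k` qubits — `η_I = 1 + (4^k − 1)ε/(4^k(1−ε))`, the `4^k − 1`
non-identity Paulis each with `η = −ε/(4^k(1−ε))` — has `Σ|η| = (1 + (1 − 2/4^k)ε)/(1−ε)`.
Pure arithmetic; only `k = 1` is tied in this file to a channel of the tree.
[cite: TemmeBravyiGambetta2017, SM §V ("The CNOT is simulated in a similar fashion")] -/
def overheadK (k : ℕ) (ε : ℝ) : ℝ :=
  (1 + (1 - 2 / 4 ^ k) * ε) / (1 - ε)

omit [Fintype ι] [DecidableEq ι] in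
/-- `Σ|η|` for the `k`-qubit pattern equals `overheadK k ε` (`0 ≤ ε < 1`).
[cite: TemmeBravyiGambetta2017, SM §V] -/
theorem overheadK_eq_sum_abs {k : ℕ} {ε : ℝ} (hε0 : 0 ≤ ε) (hε1 : ε < 1) :
    |1 + (4 ^ k - 1) * ε / (4 ^ k * (1 - ε))| + (4 ^ k - 1) * |(-ε) / (4 ^ k * (1 - ε))| =
      overheadK k ε := by
  have h1 : 0 < 1 - ε := by linarith
  have h4 : (1 : ℝ) ≤ 4 ^ k := one_le_pow₀ (by norm_num)
  have h4' : (0 : ℝ) < 4 ^ k := by positivity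
  have hI : 0 ≤ 1 + (4 ^ k - 1) * ε / (4 ^ k * (1 - ε)) := by
    have : 0 ≤ (4 ^ k - 1) * ε / (4 ^ k * (1 - ε)) := by
      apply div_nonneg (mul_nonneg (by linarith) hε0); positivity
    linarith
  have hX : (-ε) / (4 ^ k * (1 - ε)) ≤ 0 :=
    div_nonpos_of_nonpos_of_nonneg (neg_nonpos.2 hε0) (by positivity)
  rw [abs_of_nonneg hI, abs_of_nonpos hX, overheadK]
  field_simp
  ring

omit [Fintype ι] [DecidableEq ι] in
/-- `k = 1`: `(1 + ε/2)/(1 − ε)` = `overhead ε`. [cite: TemmeBravyiGambetta2017, SM §V] -/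
theorem overheadK_one (ε : ℝ) : overheadK 1 ε = overhead ε := by
  rw [overheadK, overhead]
  ring

omit [Fintype ι] [DecidableEq ι] in
/-- `k = 2`: the printed CNOT overhead `(1 + 7ε/8)/(1 − ε)`.
[cite: TemmeBravyiGambetta2017, SM §V ("simulates CNOTs with the overhead γ_β = (1+7ε/8)/(1−ε)")] -/
theorem overheadK_two (ε : ℝ) : overheadK 2 ε = (1 + 7 * ε / 8) / (1 - ε) := by
  rw [overheadK]
  ring

omit [Fintype ι] [DecidableEq ι] in
/-- The `k`-qubit insertion probability `|η|/γ = ε/(4^k + (4^k − 2)ε)` of each non-identity Pauli.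
[cite: TemmeBravyiGambetta2017, SM §V] -/
def probK (k : ℕ) (ε : ℝ) : ℝ :=
  ε / (4 ^ k + (4 ^ k - 2) * ε)

omit [Fintype ι] [DecidableEq ι] in
/-- `probK = |η_{P≠I}| / Σ|η|` for `0 ≤ ε < 1`. [cite: TemmeBravyiGambetta2017, SM §IV ("P_β(α) = μ_α/γ_β")] -/
theorem probK_eq_div {k : ℕ} {ε : ℝ} (hε0 : 0 ≤ ε) (hε1 : ε < 1) :
    probK k ε = (ε / (4 ^ k * (1 - ε))) / overheadK k ε := by
  have h1 : (1 - ε) ≠ 0 := by linarith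
  have h4' : (0 : ℝ) < 4 ^ k := by positivity
  have hden : 4 ^ k + (4 ^ k - 2) * ε ≠ 0 := by
    have : (1 : ℝ) ≤ 4 ^ k := one_le_pow₀ (by norm_num)
    nlinarith
  have hnum : 1 + (1 - 2 / 4 ^ k) * ε ≠ 0 := by
    have : (1 : ℝ) ≤ 4 ^ k := one_le_pow₀ (by norm_num)
    have h2 : 2 / (4 : ℝ) ^ k ≤ 2 := by
      rw [div_le_iff₀ h4']; nlinarith
    nlinarith
  rw [probK, overheadK]
  field_simp

omit [Fintype ι] [DecidableEq ι] in
/-- `k = 1`: `ε/(4 + 2ε)` = `prob ε Q` for `Q ≠ I`. [cite: TemmeBravyiGambetta2017, SM §V ("p_1 = ε/(4+2ε)")] -/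
theorem probK_one (ε : ℝ) {Q : Pauli} (hQ : Q ≠ Pauli.I) : probK 1 ε = prob ε Q := by
  rw [probK, prob, if_neg hQ]
  ring

omit [Fintype ι] [DecidableEq ι] in
/-- `k = 2`: the printed `p_2 = ε/(16 + 14ε)`. [cite: TemmeBravyiGambetta2017, SM §V ("p_2 = ε/(16+14ε)")] -/
theorem probK_two (ε : ℝ) : probK 2 ε = ε / (16 + 14 * ε) := by
  rw [probK]
  ring

end Depolarizing

end PEC

end Literature.Computability.QuantumComplexity
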